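import Literature.AlgebraicGeometry.Resolution.MarkedIdealsLemmas
import Literature.AlgebraicGeometry.Resolution.HypersurfaceRestrictionTransform
import Literature.AlgebraicGeometry.Resolution.BlowupsProduct
import Literature.AlgebraicGeometry.Resolution.RetractionBlowupTransform
import Literature.AlgebraicGeometry.Resolution.StrictTransformBaseChange
import Literature.AlgebraicGeometry.Resolution.PrimeDivisorIdeals
import Literature.AlgebraicGeometry.Resolution.StrictTransformDistinct
import Literature.AlgebraicGeometry.Resolution.BoundarySplitting
import Summits.ResolutionOfSingularities.ResolutionOfSingularities.Theorems.EquisingularLiftEquisingularLiftNatCarrierDeltaStalks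
import Summits.ResolutionOfSingularities.ResolutionOfSingularities.Theorems.EquisingularLiftEquisingularLiftNatCarrierDeltaComap
import HarnessLib

/-!
# [OURS · L1 W4.5(b) · EL♮(3) · WIDTH TABLE D5 «IMMATURE HOST» brick G1] THE CARRIED-INCIDENCE CALCULUS OF A KEY LETTER

Desk WIDTH TABLE D5 (2026-08-28), engine row of res-L1-w45b-stub-4 g11: the G1 rules of the joint clause proposal D5-0b v1.1 (Δ-β, desk R47/R49/R53).
`--supports stmt-ResolutionOfSingularities-20148`, no claim, counted 0.  AI-produced; NOT a statement of [Hironaka2017]; EL♮(3) is NOT proved here.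

The CARRIED INCIDENCE of a key letter `M` is the inequality `𝓜 ≤ Σ_{m ∈ Inc} ∏_{i ∈ m} 𝓛 i` — its model lies in a SUM OF MONOMIALS `Inc : List (List ι)` in the listed
members' models (`X.IdealSheafData` is an idempotent commutative semiring, `+ = ⊔`); stated UNFOLDED here (res-type-027's Defs8 names it).
* `le_of_keyInc` — CONSUMPTION: if every monomial has a factor whose model lies in `𝒞` (downstairs: «a factor ∈ {A, B}», the pair members), then `𝓜 ≤ 𝒞` — the
  `hord`/`h𝓔C` input of Δ2b ✓ p666982 / HT2′ ✓ p661346.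
* ★ `keyInc_transport` — TRANSPORT through a blow-up with exceptional `𝓔` (effective Cartier): from the per-member bounds `(𝓛 i)·𝒪 ≤ 𝓔^{eᵢ}·𝓛'ᵢ`, the key letter's
  factorization `𝓔^a·𝓜' ≤ 𝓜·𝒪` and the SUPPORT CONDITION `a ≤ Σ_{i ∈ m} eᵢ` for every monomial: `𝓜' ≤ Σ 𝓔^{Σe − a}·∏ 𝓛'` (and the coarse form without the
  exceptional powers) — pure ideal-sheaf algebra (Literature `comap_mul`, `IsEffectiveCartier.le_of_mul_le_mul`).
* the per-member bounds: `comap_le_pow_zero_mul_strictTransformIdeal` (ANY member, weight 0), `comap_le_pow_one_mul_strictTransformIdeal` (a member CONTAINING the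
  centre, `𝓛 ≤ 𝒞`, weight 1; Literature `IsBlowup.comap_mul_controlledTransform_one`; no regularity).
* `le_of_forall_isClosed_stalkIdeal_le` — on a quasi-compact scheme ideal-sheaf inequalities are checked at CLOSED points (Literature `stalkIdeal_map_stalkSpecializes`).
* ★ `comap_eq_pow_mul_strictTransformIdeal_of_packs` — the key letter's factorization `𝓜·𝒪 = 𝓔^a · St 𝓜` from the CONE PACKS of Δ2a/Δ2b at the closed points of the
  centre's support (order EXACTLY `a` ALONG THE CENTRE, jump points of the 𝔪-adic order allowed — unlike Kollár 3.60 / Literature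
  `IsBlowup.comap_eq_pow_mul_strictTransformIdeal_of_forall_isPrincipal`), via res-type-100's stalk theorem `exists_stalk_strictTransformIdeal_sup_comap`.
-/

set_option linter.dupNamespace false

noncomputable section

universe u

open CategoryTheory AlgebraicGeometry TopologicalSpace
open Literature.AlgebraicGeometry.Resolution
open AlgebraicGeometry.Scheme.IdealSheafData

namespace Summit.ResolutionOfSingularities.ResolutionOfSingularities.Cruxes.EquisingularLiftNat.Sections

section KeyInc

variable {X X₂ : Scheme.{u}} (τ : X₂ ⟶ X) {ι : Type*}

/-! The CARRIED INCIDENCE of a key letter is the inequality `𝓜 ≤ (Inc.map fun m => (m.map 𝓛).prod).sum` — the key letter's model lies in the sum of the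
MONOMIALS `Inc : List (List ι)` in the listed members' models `𝓛 : ι → X.IdealSheafData` (`X.IdealSheafData` is an idempotent commutative semiring with `+ = ⊔`).  It is
stated UNFOLDED below (no definition in a proof file); res-type-027's Defs8 may name it `KeyInc`. -/

/-- `comap` of a product of a list of ideal sheaves. -/
theorem comap_list_prod (l : List X.IdealSheafData) : (l.prod).comap τ = (l.map fun K => K.comap τ).prod := by
  induction l with
  | nil => simp [Scheme.IdealSheafData.comap_top]
  | cons K l ih => rw [List.prod_cons, List.map_cons, List.prod_cons, comap_mul, ih]

/-- `comap` of a sum of a list of ideal sheaves. -/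
theorem comap_list_sum (l : List X.IdealSheafData) : (l.sum).comap τ = (l.map fun K => K.comap τ).sum := by
  induction l with
  | nil => simp
  | cons K l ih => rw [List.sum_cons, List.map_cons, List.sum_cons, add_eq_sup, add_eq_sup, Scheme.IdealSheafData.comap_sup, ih]

/-- A product of bounds: `∏ comap (𝓛 i) ≤ 𝓔 ^ (Σ e) * ∏ 𝓛' i`. -/
theorem list_prod_comap_le (𝓛 : ι → X.IdealSheafData) (𝓛' : ι → X₂.IdealSheafData) (e : ι → ℕ) (𝓔 : X₂.IdealSheafData)
    (hL : ∀ i, (𝓛 i).comap τ ≤ 𝓔 ^ e i * 𝓛' i) (m : List ι) :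
    ((m.map 𝓛).prod).comap τ ≤ 𝓔 ^ (m.map e).sum * (m.map 𝓛').prod := by
  induction m with
  | nil => simp [Scheme.IdealSheafData.comap_top]
  | cons i m ih =>
    rw [List.map_cons, List.prod_cons, comap_mul, List.map_cons, List.sum_cons, List.map_cons, List.prod_cons, pow_add]
    calc (𝓛 i).comap τ * ((m.map 𝓛).prod).comap τ
        ≤ (𝓔 ^ e i * 𝓛' i) * (𝓔 ^ (m.map e).sum * (m.map 𝓛').prod) := mul_le_mul' (hL i) ih
      _ = 𝓔 ^ e i * 𝓔 ^ (m.map e).sum * (𝓛' i * (m.map 𝓛').prod) := by ring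

/-- In the lattice-semiring of ideal sheaves every element is `≤ 1 = ⊤`, so `𝓔 ^ n * P ≤ P`. -/
theorem pow_mul_le (𝓔 P : X.IdealSheafData) (n : ℕ) : 𝓔 ^ n * P ≤ P := by
  calc 𝓔 ^ n * P ≤ 1 * P := mul_le_mul' (by rw [one_eq_top]; exact le_top) le_rfl
    _ = P := one_mul P

/-- **CONSUMPTION of the carried incidence at a pair round / host move**: if every monomial of `Inc` has a factor whose model lies in `𝒞` (downstairs: «a factor
∈ {A, B}», the pair members), then `𝓜 ≤ 𝒞` — the `hord`/`h𝓔C` input of Δ2b ✓ p666982 / HT2′ ✓ p661346. [OURS · L1 W4.5b · D5 G1] -/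
theorem le_of_keyInc {𝓜 𝒞 : X.IdealSheafData} {𝓛 : ι → X.IdealSheafData} {Inc : List (List ι)}
    (hInc : 𝓜 ≤ (Inc.map fun m : List ι => (m.map 𝓛).prod).sum)
    (hfac : ∀ m ∈ Inc, ∃ i ∈ m, 𝓛 i ≤ 𝒞) : 𝓜 ≤ 𝒞 := by
  refine hInc.trans ?_
  clear hInc
  induction Inc with
  | nil => simp
  | cons m Inc ih =>
    rw [List.map_cons, List.sum_cons, add_eq_sup, sup_le_iff]
    refine ⟨?_, ih (fun m' hm' => hfac m' (List.mem_cons_of_mem _ hm'))⟩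
    obtain ⟨i, hi, hiC⟩ := hfac m List.mem_cons_self
    exact (IdealSheafData.prod_le_of_mem (List.mem_map.mpr ⟨i, hi, rfl⟩)).trans hiC

/-- **G1 — TRANSPORT OF THE CARRIED INCIDENCE THROUGH A BLOW-UP.**  Let `τ` be a morphism, `𝓔` an effective Cartier ideal on the source (the exceptional ideal), the
listed members' models bounded by `(𝓛 i)·𝒪 ≤ 𝓔^{eᵢ} · 𝓛'ᵢ` (`eᵢ = 0`: any member, `𝓛'` = its strict transform; `eᵢ = 1`: a member CONTAINING the centre) and the key
letter's model factored from below `𝓔^a · 𝓜' ≤ 𝓜·𝒪` (`𝓜'` = its strict transform, `a` = its generic order along the centre).  If `𝓜 ≤ Σ_{m ∈ Inc} ∏ 𝓛` and every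
monomial has weight `Σ_{i ∈ m} eᵢ ≥ a` (the SUPPORT CONDITION), then `𝓜' ≤ Σ_{m ∈ Inc} 𝓔^{Σ e − a} · ∏ 𝓛'` — and, dropping the exceptional powers,
`KeyInc 𝓜' 𝓛' Inc`.  Pure ideal-sheaf algebra: `comap` is multiplicative/additive (Literature `comap_mul`, Mathlib `comap_sup`) and an effective Cartier ideal cancels
(Literature `IsEffectiveCartier.le_of_mul_le_mul`). [OURS · L1 W4.5b · D5 G1] -/
theorem keyInc_transport (𝓔 : X₂.IdealSheafData) (h𝓔 : IsEffectiveCartier 𝓔) (𝓛 : ι → X.IdealSheafData) (𝓛' : ι → X₂.IdealSheafData) (e : ι → ℕ)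
    (hL : ∀ i, (𝓛 i).comap τ ≤ 𝓔 ^ e i * 𝓛' i) {𝓜 : X.IdealSheafData} {𝓜' : X₂.IdealSheafData} {a : ℕ}
    (h𝓜 : 𝓔 ^ a * 𝓜' ≤ 𝓜.comap τ) {Inc : List (List ι)} (hInc : 𝓜 ≤ (Inc.map fun m : List ι => (m.map 𝓛).prod).sum)
    (hsupp : ∀ m ∈ Inc, a ≤ (m.map e).sum) :
    𝓜' ≤ (Inc.map fun m : List ι => 𝓔 ^ ((m.map e).sum - a) * (m.map 𝓛').prod).sum ∧
      𝓜' ≤ (Inc.map fun m : List ι => (m.map 𝓛').prod).sum := by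
  have hmono : ∀ m ∈ Inc, ((m.map 𝓛).prod).comap τ ≤ 𝓔 ^ a * (𝓔 ^ ((m.map e).sum - a) * (m.map 𝓛').prod) := by
    intro (m : List ι) hm
    rw [← mul_assoc, ← pow_add, Nat.add_sub_cancel' (hsupp m hm)]
    exact list_prod_comap_le τ 𝓛 𝓛' e 𝓔 hL m
  have key : 𝓜' ≤ (Inc.map fun m : List ι => 𝓔 ^ ((m.map e).sum - a) * (m.map 𝓛').prod).sum := by
    apply (h𝓔.pow a).le_of_mul_le_mul
    calc 𝓔 ^ a * 𝓜' ≤ 𝓜.comap τ := h𝓜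
      _ ≤ ((Inc.map fun m : List ι => (m.map 𝓛).prod).sum).comap τ := Scheme.IdealSheafData.comap_mono τ hInc
      _ = (Inc.map fun m : List ι => ((m.map 𝓛).prod).comap τ).sum := by rw [comap_list_sum, List.map_map]; rfl
      _ ≤ (Inc.map fun m : List ι => 𝓔 ^ a * (𝓔 ^ ((m.map e).sum - a) * (m.map 𝓛').prod)).sum := List.sum_le_sum hmono
      _ = 𝓔 ^ a * (Inc.map fun m : List ι => 𝓔 ^ ((m.map e).sum - a) * (m.map 𝓛').prod).sum := by rw [List.sum_map_mul_left]
  refine ⟨key, key.trans (List.sum_le_sum fun m _ => pow_mul_le _ _ _)⟩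

/-! ## The per-member bounds `(𝓛 i)·𝒪 ≤ 𝓔^{eᵢ} · St 𝓛ᵢ` -/

/-- Weight `0` (ANY member): the total transform lies in the strict transform. -/
theorem comap_le_pow_zero_mul_strictTransformIdeal (C L : X.IdealSheafData) :
    L.comap τ ≤ C.comap τ ^ 0 * strictTransformIdeal τ C L := by
  rw [pow_zero, one_mul]; exact comap_le_strictTransformIdeal τ C L

/-- Weight `1` (a member CONTAINING the centre, `L ≤ C`): the exceptional ideal divides the total transform once, `L·𝒪 = 𝓔 · (L·𝒪 : 𝓔) ≤ 𝓔 · St L`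
(Literature `IsBlowup.comap_mul_controlledTransform_one`). No regularity needed. -/
theorem comap_le_pow_one_mul_strictTransformIdeal {C : X.IdealSheafData} (hτ : IsBlowup τ C) {L : X.IdealSheafData} (hL : L ≤ C) :
    L.comap τ ≤ C.comap τ ^ 1 * strictTransformIdeal τ C L := by
  rw [pow_one, ← hτ.comap_mul_controlledTransform_one hL]
  exact mul_le_mul' le_rfl (controlledTransform_le_strictTransformIdeal τ C L 1)

/-! ## Closed points suffice on a quasi-compact scheme -/

/-- Every point of a quasi-compact scheme specialises to a closed point. [folklore] -/
theorem exists_specializes_isClosed {Y : Scheme.{u}} [CompactSpace Y] (y : Y) : ∃ y₀ : Y, y ⤳ y₀ ∧ IsClosed ({y₀} : Set Y) := by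
  obtain ⟨y₀, hy₀, hcl⟩ := (isClosed_closure (s := ({y} : Set Y))).exists_closed_singleton ⟨y, subset_closure rfl⟩
  exact ⟨y₀, specializes_iff_mem_closure.mpr hy₀, hcl⟩

/-- **On a quasi-compact scheme an inequality of ideal sheaves is checked on the stalks at closed points** (the stalk at a point is a localisation of the
stalk at any closed specialisation, Literature `stalkIdeal_map_stalkSpecializes`). [folklore] -/
theorem le_of_forall_isClosed_stalkIdeal_le {Y : Scheme.{u}} [CompactSpace Y] {I J : Y.IdealSheafData}
    (h : ∀ y : Y, IsClosed ({y} : Set Y) → stalkIdeal I y ≤ stalkIdeal J y) : I ≤ J := by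
  refine le_of_forall_stalkIdeal_le fun y => ?_
  obtain ⟨y₀, hy, hy₀⟩ := exists_specializes_isClosed y
  rw [← stalkIdeal_map_stalkSpecializes I hy, ← stalkIdeal_map_stalkSpecializes J hy]
  exact Ideal.map_mono (h y₀ hy₀)


/-! ## The key letter's factorization `𝓜·𝒪 = 𝓔^a · St 𝓜` from the cone packs (order EXACTLY `a` along the centre — generic, jump points allowed) -/

set_option maxHeartbeats 800000 in -- one instance of res-type-100's chart-algebra stalk theorem (as F⁺5)
/-- **Total transform = exceptional^a · strict transform, for a hypersurface of order EXACTLY `a` along the centre** — from the CONE PACKS at the closed points of the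
centre's support (frame `c` of `J_p` quasi-regular with domain quotient, `K_p = (Φ(c))`, `Φ` a form of degree `a`, `Φ ≢ 0 mod (c)`): on a quasi-compact blown-up
scheme the identity is checked at closed points (`le_of_forall_isClosed_stalkIdeal_le`); off the exceptional locus both sides are the total transform; at a point over
the centre res-type-100's stalk theorem `exists_stalk_strictTransformIdeal_sup_comap` presents `𝓔_{x'} = (t)`, `St K_{x'} = (Φ(c/t))` and `K·𝒪_{x'} = (t^a Φ(c/t))`.
The 𝔪-adic `idealOrder` version (Literature `IsBlowup.comap_eq_pow_mul_strictTransformIdeal_of_forall_isPrincipal`, Kollár 3.60) needs the 𝔪-order CONSTANT along the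
centre; this one only needs the order ALONG THE CENTRE constant (S10's M♮ along L̃: 𝒞-order 1 everywhere, 𝔪-order 2 at the three A₁ points).
[cite: StacksProject, Tag 0804] [cite: Kollar2007, 3.58–3.60] [OURS · L1 W4.5b · D5 G1] -/
theorem comap_eq_pow_mul_strictTransformIdeal_of_packs {X X₂ : Scheme.{0}} [IsLocallyNoetherian X] [IsLocallyNoetherian X₂] [CompactSpace X₂]
    (τ : X₂ ⟶ X) (J K : X.IdealSheafData) (hτ : IsBlowup τ J) (a : ℕ) (hτcl : ∀ x' : X₂, IsClosed ({x'} : Set X₂) → IsClosed ({τ x'} : Set X))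
    (hpack : ∀ p ∈ J.support, IsClosed ({p} : Set X) → ∃ (r : ℕ) (c : Fin r → X.presheaf.stalk p) (Φ : MvPolynomial (Fin r) (X.presheaf.stalk p)),
      Ideal.span (Set.range c) = stalkIdeal J p ∧ IsQuasiRegular c ∧ IsDomain (X.presheaf.stalk p ⧸ Ideal.span (Set.range c)) ∧
      Φ.IsHomogeneous a ∧ MvPolynomial.map (Ideal.Quotient.mk (Ideal.span (Set.range c))) Φ ≠ 0 ∧ stalkIdeal K p = Ideal.span {MvPolynomial.eval c Φ}) :
    K.comap τ = J.comap τ ^ a * strictTransformIdeal τ J K := by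
  classical
  have key : ∀ x' : X₂, IsClosed ({x'} : Set X₂) →
      stalkIdeal (K.comap τ) x' = stalkIdeal (J.comap τ ^ a * strictTransformIdeal τ J K) x' := by
    intro x' hx'cl
    rw [stalkIdeal_mul, stalkIdeal_pow]
    by_cases hx' : τ x' ∈ (J.support : Set X)
    · obtain ⟨r, c, Φ, hcJ, hc, hdom, hΦd, hΦ, hK⟩ := hpack (τ x') hx' (hτcl x' hx'cl)
      haveI := hdom
      obtain ⟨j, 𝔔, χ, e, hχ, -, -, hE, hSt, -, -⟩ := exists_stalk_strictTransformIdeal_sup_comap hτ K x' hx' c hcJ hc Φ hΦd hΦ hK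
      -- the total transform at `x'`
      have htot : stalkIdeal (K.comap τ) x' = Ideal.span {χ (algebraMap _ _ (MvPolynomial.eval c Φ))} := by
        rw [stalkIdeal_comap_eq_map_stalkMap, hK, Ideal.map_span, Set.image_singleton, hχ]
      -- homogeneity: `Φ(c) = t^a · Φ(c/t)` in the blow-up algebra
      have hhom : algebraMap _ (blowupAlgebra (Ideal.span (Set.range c)) (c j)) (MvPolynomial.eval c Φ) =
          algebraMap _ (blowupAlgebra (Ideal.span (Set.range c)) (c j)) (c j) ^ a * MvPolynomial.aeval (blowupAlgebra.frac c j) Φ := by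
        have h1 : (fun i => algebraMap _ (blowupAlgebra (Ideal.span (Set.range c)) (c j)) (c i)) =
            algebraMap _ (blowupAlgebra (Ideal.span (Set.range c)) (c j)) (c j) • (blowupAlgebra.frac c j) := by
          funext i
          simp only [Pi.smul_apply, smul_eq_mul]
          exact (blowupAlgebra.algebraMap_mul_gen (Ideal.span (Set.range c)) (c j) (c i) _).symm
        calc algebraMap _ (blowupAlgebra (Ideal.span (Set.range c)) (c j)) (MvPolynomial.eval c Φ)
            = MvPolynomial.eval₂ (algebraMap _ (blowupAlgebra (Ideal.span (Set.range c)) (c j)))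
                (fun i => algebraMap _ (blowupAlgebra (Ideal.span (Set.range c)) (c j)) (c i)) Φ := by
              rw [show MvPolynomial.eval c Φ = MvPolynomial.eval₂ (RingHom.id _) c Φ from rfl, MvPolynomial.eval₂_comp_left, RingHom.comp_id]
              rfl
          _ = MvPolynomial.eval (algebraMap _ (blowupAlgebra (Ideal.span (Set.range c)) (c j)) (c j) • (blowupAlgebra.frac c j))
                (MvPolynomial.map (algebraMap _ (blowupAlgebra (Ideal.span (Set.range c)) (c j))) Φ) := by
              rw [MvPolynomial.eval₂_eq_eval_map, h1]
          _ = algebraMap _ (blowupAlgebra (Ideal.span (Set.range c)) (c j)) (c j) ^ a *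
                MvPolynomial.eval (blowupAlgebra.frac c j) (MvPolynomial.map (algebraMap _ (blowupAlgebra (Ideal.span (Set.range c)) (c j))) Φ) :=
              eval_smul_of_isHomogeneous' (hΦd.map _) _ _
          _ = algebraMap _ (blowupAlgebra (Ideal.span (Set.range c)) (c j)) (c j) ^ a * MvPolynomial.aeval (blowupAlgebra.frac c j) Φ := by
              rw [MvPolynomial.aeval_def, MvPolynomial.eval₂_eq_eval_map]
      rw [htot, hhom, map_mul, map_pow, ← Ideal.span_singleton_mul_span_singleton, ← Ideal.span_singleton_pow, ← hE, ← hSt]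
    · -- off the exceptional locus
      have hx'E : x' ∉ (J.comap τ).support := by
        intro h
        apply hx'
        have h' : x' ∈ ((J.comap τ).support : Set X₂) := h
        rw [Scheme.IdealSheafData.support_comap] at h'
        exact h'
      rw [stalkIdeal_eq_top_of_not_mem_support hx'E, Ideal.top_pow, Ideal.top_mul, stalkIdeal_strictTransformIdeal_of_not_mem τ J K hx'E,
        stalkIdeal_comap_eq_map_stalkMap]
  refine le_antisymm (le_of_forall_isClosed_stalkIdeal_le fun x' hx' => (key x' hx').le)
    (le_of_forall_isClosed_stalkIdeal_le fun x' hx' => (key x' hx').ge)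


end KeyInc

end Summit.ResolutionOfSingularities.ResolutionOfSingularities.Cruxes.EquisingularLiftNat.Sections

end
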